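import Literature.Geometry.Lorentzian.CoordBochner
import Literature.Geometry.Lorentzian.CoordHarmonicCurvature
import Literature.Geometry.Lorentzian.ConformalCoordCurvature
import HarnessLib

/-!
# Hamilton's identities for gradient Ricci solitons, in coordinates:
# `S + Δf = nλ`, `∇Ric = −∇Hess f`, `dS = 2 Ric(∇f, ·)`, `d(S + |∇f|² − 2λf) = 0`

A further layer of the coordinate tensor calculus of metric components
`G : E → (E →L E →L ℝ)`, smooth, symmetric and nondegenerate on an open set `V` of a
finite-dimensional real normed space `E` (`MetricCoord.IsMetricOn G V`, `CoordCurvature.lean`),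
with Ricci form `Ric = ricAt G`, scalar curvature `S = scalAt G`, Hessian `Hess f = hessAt G f`,
Laplacian `Δf = lapAt G f`, gradient square `|∇f|² = gradSqAt G f` and `♯ = sharpAt G`.
For components satisfying the **gradient Ricci soliton equation**

  `Ric + Hess f = λ G` on `V` (`λ ∈ ℝ`; shrinking for `λ > 0`, e.g. `λ = ½`),

we PROVE the classical first-order identities of R. S. Hamilton (*The formation of singularities
in the Ricci flow*, Surveys in Diff. Geom. 2 (1995), §20; Cao–Chen–Zhu 2008, Lemma 4.1 / (4.2)–(4.4);
Eminenti–La Nave–Mantegazza 2008, Lemma 1.1; Petersen–Wylie 2009, (2.1)–(2.3)):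

* `scalAt_add_lapAt_of_soliton` — **the traced soliton equation** `S + Δf = λ dim E`;
* `IsMetricOn.cov₂At_ricAt_of_soliton` — `∇Ric = −∇Hess f` (`∇G = 0`,
  `CoordHarmonicCurvature.cov₂At_self`);
* `IsMetricOn.fderiv_scalAt_of_soliton` — **`dS(Y) = 2 Ric(♯Df, Y)`**, i.e. `∇S = 2 Ric(∇f, ·)`:
  the contracted Bianchi identity `dS = 2 div Ric` (`CoordBianchi.fderiv_scalAt'`), the divergence
  of the Hessian `div Hess f = dΔf + Ric(♯Df, ·)` (`CoordBochner.sum_ginv_cov₂At_hessAt`, the Ricci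
  identity) and `dΔf = −dS` (the traced equation) give `dS = −2(−dS + Ric(♯Df, ·))`;
* `IsMetricOn.fderiv_scalAt_of_soliton'` — the same as `dS(Y) = 2λ Df(Y) − 2 Hess f(♯Df, Y)`;
* `IsMetricOn.fderiv_scalAt_add_gradSqAt_of_soliton` — **`d(S + |∇f|² − 2λ f) = 0`**
  (`d|∇f|²(Y) = 2 Hess f(Y, ♯Df)`, `CoordBochner.fderiv_gradSqAt`), Hamilton's conserved quantity
  (so that on a connected soliton `S + |∇f|² − 2λf` is a constant, normalised to `0` in
  `threeShrinkerClassification_modelData` with `λ = ½`).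

Everything is proved by the coordinate calculus of the files cited; no definition and no
statement of `Prop` type is introduced. These are the pointwise inputs of both halves of the
classification of three-dimensional shrinking solitons (the elliptic equations
`Δ_f S = S − 2|Ric|²` etc. are their second-order consequences).

## References

* O. Munteanu, J. Wang, *Structure at infinity for shrinking Ricci solitons*, arXiv:1606.01861,
  §2 (p. 6): `∇S = 2Ric(∇f)`, `Δ_f S = S − 2|Ric|²`, normalisation `S + |∇f|² = f`.
  [MunteanuWang2016]
* R. S. Hamilton, *The formation of singularities in the Ricci flow*, Surveys in Differential
  Geometry 2 (1995) 7–136, §20 (identities for gradient solitons). [Hamilton1995]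
* H.-D. Cao, B.-L. Chen, X.-P. Zhu, *Recent developments on Hamilton's Ricci flow*, Surveys in
  Differential Geometry XII (2008), Lemma 4.1 and (4.2)–(4.4). [CaoChenZhu2007]
* B. O'Neill, *Semi-Riemannian geometry with applications to relativity*, Academic Press 1983,
  Ch. 3, Cor. 3.54 (`dS = 2 div Ric`), Def. 3.48–3.50. [ONeill1983]
* P. Topping, *Lectures on the Ricci flow*, LMS Lecture Note Series 325, CUP 2006, (2.1.9) and the
  proof of Prop. 8.2.6. [Topping2006]
-/

noncomputable section

set_option maxSynthPendingDepth 3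

open Set Filter ContinuousLinearMap Module
open scoped Topology ContDiff

namespace Literature.Geometry.Lorentzian

namespace MetricCoord

variable {E : Type*} [NormedAddCommGroup E] [NormedSpace ℝ E] [FiniteDimensional ℝ E]
  {G : E → E →L[ℝ] E →L[ℝ] ℝ} {V : Set E} {x : E} {f : E → ℝ} {lam : ℝ}

/-! ### The traced soliton equation -/

/-- **The traced soliton equation `S + Δf = λ · dim E`** (trace of `Ric + Hess f = λ G` through
the metric: `tr_G Ric = S`, `tr_G Hess f = Δf`, `tr_G G = dim E` (`mtrAt_self`,
`ConformalCoordCurvature.lean`); Cao–Chen–Zhu 2008, (4.3):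
`R + Δf = n/2` for `λ = ½`). [cite: CaoChenZhu2007, Lemma 4.1] -/
theorem scalAt_add_lapAt_of_soliton (hi : (G x).IsInvertible)
    (hsol : ∀ v w, ricAt G x v w + hessAt G f x v w = lam * G x v w) :
    scalAt G x + lapAt G f x = lam * finrank ℝ E := by
  have hform : ricAt G x + hessAt G f x = lam • G x := by
    ext v w
    simpa using hsol v w
  rw [scalAt, lapAt, ← mtrAt_add, hform, mtrAt_smul, mtrAt_self hi]

/-- Near a point of `V` the soliton equation reads `Ric = λ G − Hess f` as an identity of fields.
[cite: CaoChenZhu2007, Lemma 4.1] -/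
theorem IsMetricOn.ricAt_eventuallyEq_of_soliton (hG : IsMetricOn G V) (hx : x ∈ V)
    (hsol : ∀ y ∈ V, ∀ v w, ricAt G y v w + hessAt G f y v w = lam * G y v w) :
    ricAt G =ᶠ[𝓝 x] fun y ↦ lam • G y - hessAt G f y := by
  filter_upwards [hG.mem_nhds hx] with y hy
  ext v w
  have h := hsol y hy v w
  simp only [FunLike.coe_sub, Pi.sub_apply, FunLike.coe_smul, Pi.smul_apply,
    smul_eq_mul]
  linarith

variable [CompleteSpace E]

/-! ### `∇Ric = −∇Hess f` -/

/-- **`∇Ric = −∇ Hess f` for soliton components**: differentiate `Ric = λG − Hess f` covariantly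
and use `∇G = 0` (`cov₂At_self`). [cite: CaoChenZhu2007, Lemma 4.1] [cite: ONeill1983, Ch. 3, Prop. 3.13] -/
theorem IsMetricOn.cov₂At_ricAt_of_soliton (hG : IsMetricOn G V) (hx : x ∈ V)
    (hf : ContDiffOn ℝ ∞ f V)
    (hsol : ∀ y ∈ V, ∀ v w, ricAt G y v w + hessAt G f y v w = lam * G y v w) :
    cov₂At G (ricAt G) x = -cov₂At G (hessAt G f) x := by
  have hev := hG.ricAt_eventuallyEq_of_soliton hx hsol
  have hGd := hG.differentiableAt hx
  have hHd := hG.differentiableAt_hessAt hx hf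
  have hself := hG.cov₂At_self hx
  rw [cov₂At_congr hev]
  ext W Y Z
  have h0 : cov₂At G G x W Y Z = 0 := by rw [hself]; rfl
  have hd : HasFDerivAt (fun y ↦ lam • G y - hessAt G f y)
      (lam • fderiv ℝ G x - fderiv ℝ (hessAt G f) x) x :=
    (hGd.hasFDerivAt.const_smul lam).sub hHd.hasFDerivAt
  simp only [FunLike.coe_neg, Pi.neg_apply, cov₂At_apply, hd.fderiv, FunLike.coe_sub,
    Pi.sub_apply, FunLike.coe_smul, Pi.smul_apply, smul_eq_mul] at h0 ⊢
  linear_combination lam * h0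

/-! ### Hamilton's identity `dS = 2 Ric(∇f, ·)` -/

/-- **Hamilton's identity `∇S = 2 Ric(∇f, ·)` on a gradient Ricci soliton**, in coordinates:
for metric components with `Ric + Hess f = λ G` on `V`, at every `x ∈ V` and for every `Y`,
`∂_Y S = 2 Ric(♯Df, Y)`. Proof (Cao–Chen–Zhu 2008, proof of Lemma 4.1; Hamilton 1995, §20): by
the contracted Bianchi identity `∂_Y S = 2 Σ g^{kl} (∇_{b_k} Ric)(b_l, Y)`; by `∇Ric = −∇Hess f`
and the divergence of the Hessian this is `−2 (∂_Y Δf + Ric(♯Df, Y))`; and `Δf = λ dim E − S`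
near `x`, so `∂_Y Δf = −∂_Y S`. Munteanu–Wang 2016, §2 (p. 6), first displayed identity:
"`∇S = 2Ric(∇f)`". [cite: MunteanuWang2016, §2 (p. 6)] [cite: CaoChenZhu2007, Lemma 4.1]
[cite: Hamilton1995, §20] [cite: ONeill1983, Ch. 3, Cor. 3.54] -/
theorem IsMetricOn.fderiv_scalAt_of_soliton (hG : IsMetricOn G V) (hx : x ∈ V)
    (hf : ContDiffOn ℝ ∞ f V)
    (hsol : ∀ y ∈ V, ∀ v w, ricAt G y v w + hessAt G f y v w = lam * G y v w) (Y : E) :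
    fderiv ℝ (scalAt G) x Y = 2 * ricAt G x (sharpAt G x (fderiv ℝ f x)) Y := by
  set b := Module.finBasis ℝ E
  -- contracted Bianchi + `∇Ric = −∇Hess f` + divergence of the Hessian
  have hB := hG.fderiv_scalAt' b hx Y
  have hcov := hG.cov₂At_ricAt_of_soliton hx hf hsol
  have hdiv := hG.sum_ginv_cov₂At_hessAt b hx hf Y
  have hsum : ∑ k, ∑ l, ginv G b x k l * cov₂At G (ricAt G) x (b k) (b l) Y =
      -(fderiv ℝ (lapAt G f) x Y + ricAt G x (sharpAt G x (fderiv ℝ f x)) Y) := by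
    rw [← hdiv, ← Finset.sum_neg_distrib]
    refine Finset.sum_congr rfl fun k _ ↦ ?_
    rw [← Finset.sum_neg_distrib]
    refine Finset.sum_congr rfl fun l _ ↦ ?_
    simp only [hcov, FunLike.coe_neg, Pi.neg_apply, mul_neg]
  -- `Δf = λ dim E − S` near `x`, so `∂_Y Δf = −∂_Y S`
  have hlap : lapAt G f =ᶠ[𝓝 x] fun y ↦ lam * finrank ℝ E - scalAt G y := by
    filter_upwards [hG.mem_nhds hx] with y hy
    have h := scalAt_add_lapAt_of_soliton (hG.isInvertible y hy) (hsol y hy)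
    linarith
  have hdlap : fderiv ℝ (lapAt G f) x Y = -fderiv ℝ (scalAt G) x Y := by
    rw [hlap.fderiv_eq, fderiv_const_sub, FunLike.coe_neg, Pi.neg_apply]
  rw [hsum, hdlap] at hB
  linarith

/-- **`dS(Y) = 2λ Df(Y) − 2 Hess f(♯Df, Y)`**: Hamilton's identity with `Ric = λG − Hess f`
substituted (`G(♯Df, Y) = Df(Y)`). [cite: CaoChenZhu2007, Lemma 4.1] -/
theorem IsMetricOn.fderiv_scalAt_of_soliton' (hG : IsMetricOn G V) (hx : x ∈ V)
    (hf : ContDiffOn ℝ ∞ f V)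
    (hsol : ∀ y ∈ V, ∀ v w, ricAt G y v w + hessAt G f y v w = lam * G y v w) (Y : E) :
    fderiv ℝ (scalAt G) x Y =
      2 * lam * fderiv ℝ f x Y - 2 * hessAt G f x (sharpAt G x (fderiv ℝ f x)) Y := by
  have h := hG.fderiv_scalAt_of_soliton hx hf hsol Y
  have hs := hsol x hx (sharpAt G x (fderiv ℝ f x)) Y
  rw [apply_sharpAt_apply (hG.isInvertible x hx)] at hs
  rw [h]
  linarith

/-! ### Hamilton's conserved quantity `S + |∇f|² − 2λf` -/

/-- **`d(S + |∇f|² − 2λ f) = 0` on a gradient Ricci soliton** (Hamilton 1995, §20;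
Cao–Chen–Zhu 2008, (4.4): `R + |∇f|² − f = C` for `λ = ½`; Munteanu–Wang 2016, §2 (p. 6):
"by adding a constant to `f` if necessary, we may normalize the soliton such that
`S + |∇f|² = f`"), in coordinates: `∂_Y S = 2λ Df(Y) − 2 Hess f(♯Df, Y)` and
`∂_Y |∇f|² = 2 Hess f(Y, ♯Df)` cancel by the symmetry of the Hessian.
[cite: MunteanuWang2016, §2 (p. 6)] [cite: CaoChenZhu2007, Lemma 4.1] [cite: Hamilton1995, §20] -/
theorem IsMetricOn.fderiv_scalAt_add_gradSqAt_of_soliton (hG : IsMetricOn G V) (hx : x ∈ V)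
    (hf : ContDiffOn ℝ ∞ f V)
    (hsol : ∀ y ∈ V, ∀ v w, ricAt G y v w + hessAt G f y v w = lam * G y v w) (Y : E) :
    fderiv ℝ (fun y ↦ scalAt G y + gradSqAt G f y - 2 * lam * f y) x Y = 0 := by
  have hSd : DifferentiableAt ℝ (scalAt G) x := (hG.contDiffAt_scalAt hx).differentiableAt (by simp)
  have hQd := hG.differentiableAt_gradSqAt hx hf
  have hfx : ContDiffAt ℝ ∞ f x := hf.contDiffAt (hG.mem_nhds hx)
  have hfd : DifferentiableAt ℝ f x := hfx.differentiableAt (by simp)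
  have hd : HasFDerivAt (fun y ↦ scalAt G y + gradSqAt G f y - 2 * lam * f y)
      (fderiv ℝ (scalAt G) x + fderiv ℝ (gradSqAt G f) x - (2 * lam) • fderiv ℝ f x) x :=
    (hSd.hasFDerivAt.add hQd.hasFDerivAt).sub (hfd.hasFDerivAt.const_mul (2 * lam))
  rw [hd.fderiv]
  simp only [FunLike.coe_sub, Pi.sub_apply, FunLike.coe_add,
    Pi.add_apply, FunLike.coe_smul, Pi.smul_apply, smul_eq_mul]
  rw [hG.fderiv_scalAt_of_soliton' hx hf hsol Y, hG.fderiv_gradSqAt hx hf Y,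
    hG.hessAt_comm hx hfx Y]
  ring

end MetricCoord

end Literature.Geometry.Lorentzian

end
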